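import Summits.KontsevichZagierPeriods.KontsevichZagierPeriods.Theorems.RootDecompWalshStrataConicHyperbola

/-!
# Conic descent 7/7: charts (c4), (c3); `sqrtDescent_holds`; `quadricBakerDescent_two`

Chart (c4) `e > 0`, `h = 0` (two half-lines, `√D = √e·|x − x₀|`): `x = x₀ + c·t`, `c = e^(−1/4)`
(`e c⁴ = 1`) ↦ `γ·t` (`InBaker.lines_right`, `sqrtDescent_lines`); chart (c3) `e > 0`, `h < 0`
(outside the roots): `u = x − x₀ = w₀(t² + e)/(t² − e)`, `w₀ = √(k/e)`, `k = −h`, on `{t² > e, t > 0}`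
↦ `8γek·t²/(t² − e)³` (`InBaker.hyperbola_right`, `sqrtDescent_hyperbola_out`).
**`sqrtDescent_holds : ∀ e f g γ : ℚ, SqrtDescent e f g γ`** (trichotomy on `e`, then on `h`
resp. `f`) and **`quadricBakerDescent_two`**: the support item `QuadricBakerDescent`
(stmt-KontsevichZagierPeriods-27597) with `d ≤ 3` replaced by `d ≤ 2`, verbatim otherwise —
the first GENERAL (non-specimen) stratum of the Baker-descent leaf decided inside the three
rules.  Imports: part 6; 0 sorry. [KontsevichZagier2001 §1.2; Baker1975 Thm 2.1; BCR1998 §2.2]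
-/

noncomputable section

open Literature.NumberTheory.Transcendental
open MeasureTheory Set
open MvPolynomial (aeval X C)
open Literature.ModelTheory.ExponentialFields (IsSemialgebraic isSemialgebraic_univ
  isSemialgebraic_setOf_eval_pos isSemialgebraic_setOf_eval_lt isSemialgebraic_setOf_eval_le
  isSemialgebraic_setOf_eval_nonneg isSemialgebraic_setOf_eval_eq_zero continuous_aeval_real
  tarski_seidenberg_real_holds)
open Summit.KontsevichZagierPeriods.RootDecompWalshStrata.WalshSpanProof (isSemialgebraic_cubeSet
  isBounded_cubeSet)
open Summit.KontsevichZagierPeriods.RootDecompWalshStrata.ConeSpecimen (unitIoo isSemialgebraic_unitIoo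
  unitIoo_subset_Icc mem_unitIoo)

namespace Summit.KontsevichZagierPeriods.RootDecompWalshStrata.ConicDescent

/-! #### 17. Chart (c4): `e > 0`, `h = 0` — two half-lines, `x = x₀ + c·t`, `c = e^(-1/4)` -/

/-- The derivative of `s ↦ s²` at `t` is `2t` (file-local copy). [folklore] -/
private theorem hasDerivAt_sq (t : ℝ) : HasDerivAt (fun s : ℝ => s ^ 2) (2 * t) t := by
  simpa using hasDerivAt_pow 2 t

/-- The half-line `{t > 0}` is `ℚ`-semialgebraic (private per-file copy; a verbatim twin is landed elsewhere in the tree). [BCR1998 §2.2] -/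
private theorem isSemialgebraic_T_pos : IsSemialgebraic ℚ {v : Fin 1 → ℝ | 0 < v 0} := by
  convert isSemialgebraic_setOf_eval_pos (k := ℚ) (R := ℝ)
    (MvPolynomial.X (0 : Fin 1) : MvPolynomial (Fin 1) ℚ) using 1
  ext v
  simp

/-- Right half for `h = 0`: `D = e(x − x₀)²`; `x = x₀ + c t` with `e c⁴ = 1`, `t > 0`, pulls
`γ√D` back to `γ·t`. [this node] -/
theorem InBaker.lines_right (e f g γ : ℚ) (he : 0 < e) (hh : g - f ^ 2 / (4 * e) = 0)
    (r : KZ.IntegralRep 1) (hdom : ∀ v ∈ r.domain, (((-f / (2 * e) : ℚ) : ℝ)) < v 0)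
    (hr : EqOn r.integrand (fun v => (γ : ℝ) * √(qD e f g (v 0))) r.domain) :
    InBaker (KZ.of r) := by
  have he0 : (0 : ℝ) < e := by exact_mod_cast he
  set X₀ : ℝ := ((-f / (2 * e) : ℚ) : ℝ) with hX₀def
  set c : ℝ := √(√((e : ℝ)⁻¹)) with hcdef
  have hc : 0 < c := Real.sqrt_pos.2 (Real.sqrt_pos.2 (inv_pos.2 he0))
  have hc2 : c ^ 2 = √((e : ℝ)⁻¹) := Real.sq_sqrt (Real.sqrt_nonneg _)
  have hc4 : (e : ℝ) * c ^ 4 = 1 := by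
    rw [show c ^ 4 = (c ^ 2) ^ 2 by ring, hc2, Real.sq_sqrt (inv_pos.2 he0).le,
      mul_inv_cancel₀ he0.ne']
  have hD : ∀ t : ℝ, qD e f g (X₀ + c * t) = (t / c) ^ 2 := fun t => by
    rw [qD_eq_vertex e f g he.ne', hh, ← hX₀def, div_pow, eq_div_iff (pow_ne_zero 2 hc.ne')]
    push_cast
    linear_combination t ^ 2 * hc4
  refine InBaker.of_cov₁ r isSemialgebraic_T_pos (fun t => X₀ + c * t) (fun _ => c) ?_ ?_ ?_ ?_
    (MvPolynomial.C γ * MvPolynomial.X 0) 1 (fun v _ => by simp) fun v hv hvd => ?_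
  · exact ((isSemialgebraicFunOn_ratCast isSemialgebraic_T_pos (-f / (2 * e))).add_holds
      ((IsSemialgebraicFunOn.sqrt_holds (IsSemialgebraicFunOn.sqrt_holds
        (isSemialgebraicFunOn_ratCast isSemialgebraic_T_pos e⁻¹))).mul_holds
        (isSemialgebraicFunOn_apply isSemialgebraic_T_pos 0))).congr fun v _ => by
          simp only [Pi.add_apply, Pi.mul_apply, hX₀def, hcdef, Rat.cast_inv]
  · intro v _
    simpa using ((hasDerivAt_id (v 0)).const_mul c).const_add X₀
  · intro s _ t _ hst
    have h' : X₀ + c * s 0 = X₀ + c * t 0 := hst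
    exact mul_left_cancel₀ hc.ne' (add_left_cancel h')
  · intro x hx
    have hx' : X₀ < x 0 := hdom x hx
    refine ⟨fun _ => (x 0 - X₀) / c, div_pos (sub_pos.2 hx') hc, ?_⟩
    simp only
    rw [mul_div_cancel₀ _ hc.ne']
    ring
  · have hv0 : 0 < v 0 := hv
    rw [hr hvd]
    have hlift : lift₁ (fun t => X₀ + c * t) v 0 = X₀ + c * v 0 := rfl
    simp only [hlift, hD, map_mul, MvPolynomial.aeval_C, MvPolynomial.aeval_X, map_one, div_one,
      eq_ratCast]
    rw [Real.sqrt_sq (div_pos hv0 hc).le, abs_of_pos hc]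
    field_simp

/-- `e > 0`, `h = 0`. [this node] -/
theorem sqrtDescent_lines (e f g γ : ℚ) (he : 0 < e) (hh : g - f ^ 2 / (4 * e) = 0) :
    SqrtDescent e f g γ :=
  sqrtDescent_of_pos e f g γ fun r hpos hr =>
    InBaker.split_reflect e f g γ he.ne' hh.le r hpos hr fun r₁ hdom₁ hr₁ =>
      InBaker.lines_right e f g γ he hh r₁ (fun v hv => (hdom₁ v hv).1) hr₁

/-! #### 18. Chart (c3): `e > 0`, `h < 0` — `x = x₀ + w₀(t² + e)/(t² − e)` on each branch -/

/-- The chart domain `{t | e < t², 0 < t}` is `ℚ`-semialgebraic. [BCR1998 §2.2] -/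
theorem isSemialgebraic_T_sq_gt (e : ℚ) :
    IsSemialgebraic ℚ {v : Fin 1 → ℝ | (e : ℝ) < v 0 ^ 2 ∧ 0 < v 0} := by
  convert (isSemialgebraic_setOf_eval_pos (k := ℚ) (R := ℝ)
    (MvPolynomial.X (0 : Fin 1) ^ 2 - MvPolynomial.C e : MvPolynomial (Fin 1) ℚ)).inter
    isSemialgebraic_T_pos using 1
  ext v
  simp [sub_pos]

/-- Right branch for `h < 0`: `D = e u² − k` (`k = −h > 0`, `u = x − x₀ > w₀ = √(k/e)`); the
substitution `u = w₀(t² + e)/(t² − e)`, `t > √e`, pulls `γ√D` back to `8γek·t²/(t² − e)³`.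
[this node] -/
theorem InBaker.hyperbola_right (e f g γ : ℚ) (he : 0 < e) (hh : g - f ^ 2 / (4 * e) < 0)
    (r : KZ.IntegralRep 1)
    (hdom : ∀ v ∈ r.domain, (((-f / (2 * e) : ℚ) : ℝ)) < v 0 ∧ 0 < qD e f g (v 0))
    (hr : EqOn r.integrand (fun v => (γ : ℝ) * √(qD e f g (v 0))) r.domain) :
    InBaker (KZ.of r) := by
  have he0 : (0 : ℝ) < e := by exact_mod_cast he
  have hk : (0 : ℚ) < f ^ 2 / (4 * e) - g := by linarith
  have hk0 : (0 : ℝ) < ((f ^ 2 / (4 * e) - g : ℚ) : ℝ) := by exact_mod_cast hk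
  set K : ℝ := ((f ^ 2 / (4 * e) - g : ℚ) : ℝ) with hKdef
  set X₀ : ℝ := ((-f / (2 * e) : ℚ) : ℝ) with hX₀def
  have hKe : K = f ^ 2 / (4 * e) - g := by rw [hKdef]; push_cast; ring
  have hX₀e : X₀ = -f / (2 * e) := by rw [hX₀def]; push_cast; ring
  have hHK : ((g - f ^ 2 / (4 * e) : ℚ) : ℝ) = -K := by rw [hKe]; push_cast; ring
  set w₀ : ℝ := √(K / e) with hw₀def
  have hw₀ : 0 < w₀ := Real.sqrt_pos.2 (div_pos hk0 he0)
  have hw₀sq : w₀ ^ 2 = K / e := Real.sq_sqrt (div_pos hk0 he0).le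
  have hKw : K = e * w₀ ^ 2 := by rw [hw₀sq]; field_simp
  have hG : (g : ℝ) = f ^ 2 / (4 * e) - e * w₀ ^ 2 := by rw [← hKw, hKe]; ring
  have hE : ∀ v : Fin 1 → ℝ, v ∈ {v : Fin 1 → ℝ | (e : ℝ) < v 0 ^ 2 ∧ 0 < v 0} →
      0 < v 0 ^ 2 - (e : ℝ) := fun v hv => sub_pos.2 hv.1
  -- the chart
  set V : ℝ → ℝ := fun s => (s ^ 2 + e) / (s ^ 2 - e) with hVdef
  set gφ : ℝ → ℝ := fun s => X₀ + w₀ * V s with hgdef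
  set g' : ℝ → ℝ := fun s => w₀ * (-4 * e * s) / (s ^ 2 - e) ^ 2 with hg'def
  have haq : ∀ v : Fin 1 → ℝ, aeval v ((MvPolynomial.X 0 ^ 2 - MvPolynomial.C e) ^ 3 :
      MvPolynomial (Fin 1) ℚ) = (v 0 ^ 2 - (e : ℝ)) ^ 3 := fun v => by
    simp only [map_pow, map_sub, MvPolynomial.aeval_C, MvPolynomial.aeval_X, eq_ratCast]
  have hap : ∀ v : Fin 1 → ℝ, aeval v (MvPolynomial.C (8 * γ * e * (f ^ 2 / (4 * e) - g)) *
      MvPolynomial.X 0 ^ 2 : MvPolynomial (Fin 1) ℚ) = 8 * γ * e * K * v 0 ^ 2 := fun v => by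
    simp only [map_pow, map_mul, MvPolynomial.aeval_C, MvPolynomial.aeval_X, eq_ratCast, hKdef]
    push_cast
    ring
  refine InBaker.of_cov₁ r (isSemialgebraic_T_sq_gt e) gφ g' ?_ ?_ ?_ ?_
    (MvPolynomial.C (8 * γ * e * (f ^ 2 / (4 * e) - g)) * MvPolynomial.X 0 ^ 2)
    ((MvPolynomial.X 0 ^ 2 - MvPolynomial.C e) ^ 3)
    (fun v hv => by rw [haq]; exact pow_ne_zero 3 (hE v hv).ne') fun v hv hvd => ?_
  · -- semialgebraic
    have hV : IsSemialgebraicFunOn ℚ {v : Fin 1 → ℝ | (e : ℝ) < v 0 ^ 2 ∧ 0 < v 0}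
        fun v => V (v 0) :=
      (isSemialgebraicFunOn_aeval_div_aeval (isSemialgebraic_T_sq_gt e)
        (MvPolynomial.X 0 ^ 2 + MvPolynomial.C e) (MvPolynomial.X 0 ^ 2 - MvPolynomial.C e)
        fun v hv => by
          simp only [map_sub, map_pow, MvPolynomial.aeval_C, MvPolynomial.aeval_X, eq_ratCast]
          exact (hE v hv).ne').congr fun v _ => by
        simp only [hVdef, map_sub, map_add, map_pow, MvPolynomial.aeval_C, MvPolynomial.aeval_X,
          eq_ratCast]
    have hc : IsSemialgebraicFunOn ℚ {v : Fin 1 → ℝ | (e : ℝ) < v 0 ^ 2 ∧ 0 < v 0} fun _ => w₀ :=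
      (IsSemialgebraicFunOn.sqrt_holds (isSemialgebraicFunOn_ratCast (isSemialgebraic_T_sq_gt e)
        ((f ^ 2 / (4 * e) - g) / e))).congr fun v _ => by
          rw [hw₀def, hKdef]; push_cast; ring_nf
    exact ((isSemialgebraicFunOn_ratCast (isSemialgebraic_T_sq_gt e) (-f / (2 * e))).add_holds
      (hc.mul_holds hV)).congr fun v _ => by
        simp only [hgdef, hX₀def, Pi.add_apply, Pi.mul_apply]
  · -- derivative
    intro v hv
    have h1 : HasDerivAt (fun s : ℝ => s ^ 2 + (e : ℝ)) (2 * v 0) (v 0) :=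
      (hasDerivAt_sq (v 0)).add_const (e : ℝ)
    have h2 : HasDerivAt (fun s : ℝ => s ^ 2 - (e : ℝ)) (2 * v 0) (v 0) :=
      (hasDerivAt_sq (v 0)).sub_const (e : ℝ)
    have h3 := ((h1.div h2 (hE v hv).ne').const_mul w₀).const_add X₀
    refine h3.congr_deriv ?_
    have hd := (hE v hv).ne'
    simp only [hg'def]
    field_simp
    ring
  · -- injective
    intro s hs t ht hst
    have hs0 : 0 < s 0 := hs.2
    have ht0 : 0 < t 0 := ht.2
    have h1 : V (s 0) = V (t 0) := by
      have h' : X₀ + w₀ * V (s 0) = X₀ + w₀ * V (t 0) := hst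
      exact mul_left_cancel₀ hw₀.ne' (add_left_cancel h')
    have h1' : (s 0 ^ 2 + e) / (s 0 ^ 2 - e) = (t 0 ^ 2 + e) / (t 0 ^ 2 - e) := h1
    rw [div_eq_div_iff (hE s hs).ne' (hE t ht).ne'] at h1'
    have h2 : s 0 ^ 2 = t 0 ^ 2 := by
      have h3 : (e : ℝ) * s 0 ^ 2 = e * t 0 ^ 2 := by linarith
      exact mul_left_cancel₀ he0.ne' h3
    exact (pow_left_inj₀ hs0.le ht0.le two_ne_zero).1 h2
  · -- surjective onto the domain (`u > w₀`)
    intro x hx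
    obtain ⟨hxX, hxD⟩ := hdom x hx
    obtain ⟨u, hudef⟩ : ∃ u : ℝ, u = x 0 - X₀ := ⟨_, rfl⟩
    have hu : 0 < u := by rw [hudef]; exact sub_pos.2 hxX
    have hD' : 0 < (e : ℝ) * u ^ 2 - K := by
      rw [qD_eq_vertex e f g he.ne', hHK, ← hX₀def, ← hudef] at hxD
      linarith
    have hu2 : w₀ ^ 2 < u ^ 2 := by
      rw [hw₀sq, div_lt_iff₀ he0]
      linarith
    obtain ⟨_, hwu⟩ := abs_lt_of_sq_lt_sq' hu2 hu.le
    have hum : 0 < u - w₀ := sub_pos.2 hwu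
    have hup : 0 < u + w₀ := by linarith
    obtain ⟨t, htdef⟩ : ∃ t : ℝ, t = √(e * (u + w₀) / (u - w₀)) := ⟨_, rfl⟩
    have ht : 0 < t := by rw [htdef]; exact Real.sqrt_pos.2 (div_pos (mul_pos he0 hup) hum)
    have ht2 : t ^ 2 = e * (u + w₀) / (u - w₀) := by
      rw [htdef]; exact Real.sq_sqrt (div_pos (mul_pos he0 hup) hum).le
    have hum0 : u - w₀ ≠ 0 := hum.ne'
    have hm : t ^ 2 - e = 2 * e * w₀ / (u - w₀) := by rw [ht2]; field_simp; ring
    have hp : t ^ 2 + e = 2 * e * u / (u - w₀) := by rw [ht2]; field_simp; ring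
    have hte : (e : ℝ) < t ^ 2 := by
      have : 0 < t ^ 2 - e := by rw [hm]; positivity
      linarith
    refine ⟨fun _ => t, ⟨hte, ht⟩, ?_⟩
    change X₀ + w₀ * ((t ^ 2 + e) / (t ^ 2 - e)) = x 0
    have hew : (2 : ℝ) * e * w₀ ≠ 0 := by positivity
    rw [hm, hp]
    field_simp
    rw [hudef]
    ring
  · -- the pulled-back integrand
    have hEv := hE v hv
    have hv0 : 0 < v 0 := hv.2
    have hd : v 0 ^ 2 - (e : ℝ) ≠ 0 := hEv.ne'
    have hnum : 0 < 2 * w₀ * (e : ℝ) * v 0 / (v 0 ^ 2 - e) := by positivity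
    have hWv : (e : ℝ) * (gφ (v 0)) ^ 2 + f * gφ (v 0) + g =
        (2 * w₀ * (e : ℝ) * v 0 / (v 0 ^ 2 - e)) ^ 2 := by
      simp only [hgdef, hVdef]
      rw [hG, hX₀e]
      field_simp
      ring
    have hsq : √((e : ℝ) * (gφ (v 0)) ^ 2 + f * gφ (v 0) + g) =
        2 * w₀ * (e : ℝ) * v 0 / (v 0 ^ 2 - e) := by
      rw [hWv, Real.sqrt_sq hnum.le]
    have habs : |g' (v 0)| = w₀ * (4 * e * v 0) / (v 0 ^ 2 - e) ^ 2 := by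
      simp only [hg'def]
      rw [show w₀ * (-4 * (e : ℝ) * v 0) / (v 0 ^ 2 - e) ^ 2 =
          -(w₀ * (4 * e * v 0) / (v 0 ^ 2 - e) ^ 2) by ring, abs_neg, abs_of_pos]
      positivity
    rw [hr hvd]
    have hlift : lift₁ gφ v 0 = gφ (v 0) := rfl
    simp only [qD, hlift, hap, haq]
    rw [hsq, habs, hKw]
    field_simp
    ring

/-- `e > 0`, `h < 0`. [this node] -/
theorem sqrtDescent_hyperbola_out (e f g γ : ℚ) (he : 0 < e) (hh : g - f ^ 2 / (4 * e) < 0) :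
    SqrtDescent e f g γ :=
  sqrtDescent_of_pos e f g γ fun r hpos hr =>
    InBaker.split_reflect e f g γ he.ne' hh.le r hpos hr fun r₁ hdom₁ hr₁ =>
      InBaker.hyperbola_right e f g γ he hh r₁ hdom₁ hr₁

/-! #### 19. Square-root descent and the conic stratum, unconditionally -/

/-- **Square-root descent holds** for all rational `e, f, g, γ`: every `[A, γ√(e x² + f x + g)]`
lands in the Baker sector (charts (a), (b), (c1)–(c4) and the trivial `D ≤ 0` case). [this node] -/
theorem sqrtDescent_holds (e f g γ : ℚ) : SqrtDescent e f g γ := by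
  rcases lt_trichotomy e 0 with he | rfl | he
  · rcases lt_or_ge 0 (g - f ^ 2 / (4 * e)) with hh | hh
    · exact sqrtDescent_ellipse e f g γ he hh
    · refine sqrtDescent_of_nonpos e f g γ fun x => ?_
      rw [qD_eq_vertex e f g he.ne]
      have hh' : ((g - f ^ 2 / (4 * e) : ℚ) : ℝ) ≤ 0 := by exact_mod_cast hh
      have he' : (e : ℝ) < 0 := by exact_mod_cast he
      nlinarith [sq_nonneg (x - ((-f / (2 * e) : ℚ) : ℝ))]
  · rcases eq_or_ne f 0 with rfl | hf
    · exact sqrtDescent_const g γ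
    · exact sqrtDescent_linear f g γ hf
  · rcases lt_trichotomy (g - f ^ 2 / (4 * e)) 0 with hh | hh | hh
    · exact sqrtDescent_hyperbola_out e f g γ he hh
    · exact sqrtDescent_lines e f g γ he hh
    · exact sqrtDescent_hyperbola_in e f g γ he hh

/-- **`QuadricBakerDescent` for `d ≤ 2` — the conic stratum of the rank-9 support item
`stmt-KontsevichZagierPeriods-27597`, unconditionally.**  Every weighted conic cell
`[{x ∈ (0,1)^d : P(x) > 0}, q]` with `deg P ≤ 2`, `d ≤ 2`, `q ∈ ℚ` is KZ-equivalent (rules 1–3 over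
`ℚ`) to an element of the Baker sector `⟨[N] : dim N ≤ 1, N rational⟩`. [this node] -/
theorem quadricBakerDescent_two :
    ∀ (d : ℕ) (P : MvPolynomial (Fin d) ℚ) (q : ℚ) (ρ : KZ.IntegralRep d),
      (ρ.domain = {x | (∀ j, 0 < x j ∧ x j < 1) ∧ 0 < MvPolynomial.aeval x P} ∧
        ∀ x ∈ ρ.domain, ρ.integrand x = (q : ℝ)) →
      P.totalDegree ≤ 2 → d ≤ 2 →
      ∃ y ∈ AddSubgroup.closure
          {y : KZ.FormalRep | ∃ (m : ℕ) (N : KZ.IntegralRep m), m ≤ 1 ∧ N.IsRational ∧ y = KZ.of N},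
        KZ.of ρ - y ∈ KZ.relations :=
  quadricBakerDescent_two_of_sqrtDescent sqrtDescent_holds

/-! #### 20. Corollary: the quadric stratum of the sign kernel in dimension `≤ 2`, modulo Baker -/

/-- **The conic stratum of `QuadricSignKernel`, modulo the Baker kernel.**  A vanishing
`ℤ`-combination of weighted conic Walsh cells `[(0,1)^{dᵢ} ∩ {Pᵢ > 0}, qᵢ]` with `deg Pᵢ ≤ 2`,
`dᵢ ≤ 2`, `qᵢ ∈ ℚ` is a relation — given only the BAKER KERNEL `hB`, stated VERBATIM as the type of
the tree theorem `Summit.KontsevichZagierPeriods.HurwitzMicroSectors.NormalFormPrinciple.PiBox.Dlog.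
mem_relations_of_eval_eq_zero_of_dim_le_one` (Baker's theorem in kernel form for rational
representations of dimension `≤ 1`; kept as a hypothesis only because that module's import closure
is unbuilt on the farm — discharge: `fun _ hx hv => mem_relations_of_eval_eq_zero_of_dim_le_one hx hv`).
So the `d ≤ 2` quadric stratum of the period conjecture is DECIDED by `quadricBakerDescent_two` +
Baker: descend each cell into the Baker sector, the descended combination has value `0`
(`KZ.relations_le_ker_eval_holds`), hence is a relation.  Tag: RUNG of the crux `QuadricSignKernel`
(its `dᵢ ≤ 2` slice) · PROVED modulo a landed tree theorem. [Baker1975 Thm 2.1;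
KontsevichZagier2001 §1.2 Conjecture 1; this node] -/
theorem sum_mem_relations_of_dim_le_two
    (hB : ∀ ⦃x : KZ.FormalRep⦄, x ∈ AddSubgroup.closure
        {y : KZ.FormalRep | ∃ (m : ℕ) (N : KZ.IntegralRep m), m ≤ 1 ∧ N.IsRational ∧ y = KZ.of N} →
      KZ.eval x = 0 → x ∈ KZ.relations)
    (k : ℕ) (d : Fin k → ℕ) (P : (i : Fin k) → MvPolynomial (Fin (d i)) ℚ) (q : Fin k → ℚ)
    (ρ : (i : Fin k) → KZ.IntegralRep (d i)) (c : Fin k → ℤ)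
    (hρ : ∀ i, (ρ i).domain = {x | (∀ j, 0 < x j ∧ x j < 1) ∧ 0 < MvPolynomial.aeval x (P i)} ∧
      ∀ x ∈ (ρ i).domain, (ρ i).integrand x = (q i : ℝ))
    (hdeg : ∀ i, (P i).totalDegree ≤ 2) (hd : ∀ i, d i ≤ 2)
    (hv : KZ.eval (∑ i, c i • KZ.of (ρ i)) = 0) : (∑ i, c i • KZ.of (ρ i)) ∈ KZ.relations := by
  choose y hy hrel using fun i => quadricBakerDescent_two (d i) (P i) (q i) (ρ i) (hρ i) (hdeg i) (hd i)
  have h1 : (∑ i, c i • KZ.of (ρ i)) - ∑ i, c i • y i ∈ KZ.relations := by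
    rw [← Finset.sum_sub_distrib]
    exact AddSubgroup.sum_mem _ fun i _ => by
      rw [← smul_sub]; exact AddSubgroup.zsmul_mem _ (hrel i) _
  have h2 : (∑ i, c i • y i) ∈ AddSubgroup.closure
      {y : KZ.FormalRep | ∃ (m : ℕ) (N : KZ.IntegralRep m), m ≤ 1 ∧ N.IsRational ∧ y = KZ.of N} :=
    AddSubgroup.sum_mem _ fun i _ => AddSubgroup.zsmul_mem _ (hy i) _
  have h3 : KZ.eval (∑ i, c i • y i) = 0 := by
    have h := KZ.relations_le_ker_eval_holds h1
    rw [AddMonoidHom.mem_ker, map_sub, hv, zero_sub, neg_eq_zero] at h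
    exact h
  have h4 := hB h2 h3
  have := KZ.relations.add_mem h1 h4
  simpa using this

end Summit.KontsevichZagierPeriods.RootDecompWalshStrata.ConicDescent

end
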